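import Literature.Computability.QuantumComplexity.ZXCalculusSuppMinusPi4
import HarnessLib

/-!
# `ZX_{π/4}` modulo the calculus: the triangle node and its symmetry (Appendix Lemmas 20–27 of arXiv:1705.11151)

Topic `Literature/Computability/QuantumComplexity`, continuing `ZXCalculusSuppMinusPi4.lean`
(layer T5 of the formalisation of `JeandelPerdrixVilmart2018_completeness`).

* `triangle`: JPV's triangle node `⟦T⟧ = (1 1; 0 1)`, the syntactic sugar
  `Z^{(1,2)} ⨾ (𝕀 ⊗ (X^{(1,2)} ⨾ (Z^{(1,0)}(-π/4) ⊗ Z^{(1,0)}(-π/4)))) ⨾ xLeafL 0 (π/4) ⨾ Z(π/4) ⨾ X(π/2)`;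
* **Appendix Lemma 21** (`X_pi_seq_triangle`, "NOT-triangle is symmetrical"):
  `X(π) ⨾ T = Tᵗ ⨾ X(π)`.  Our derivation goes through rule (BW) instead of the printed one
  (Lemma 20 and the 6-cycle bialgebra): flipping the two `-π/4` leaves of `T` with (K) gives
  `db 4 2 ⊗ T = √2 ⊗ T₊` with `T₊ = bwT 0 ⨾ xLeafL 0 (π/4) ⨾ Z(π/4) ⨾ X(π/2)` (`triangle_flip`);
  pushing `X(π)` through the green node ((K1)) turns `T₊` into the right-hand side of (BW)
  *on the nose* (`X_pi_seq_trianglePlus`); the left-hand side of (BW) is a palindrome of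
  self-transposed blocks (`bwT_transpose`, `xLeafL_transpose`), hence `X(π) ⨾ T` is its own
  transpose;
* the red and green `0`/`π` states on the triangle and on the upside-down triangle
  (Appendix Lemmas 22–27).

## References

* E. Jeandel, S. Perdrix, R. Vilmart, LICS 2018 (arXiv:1705.11151v2), §6 (definition of the
  triangle) and Fig. 1 rules (BW), (K) [JeandelPerdrixVilmart2018].
* E. Jeandel, S. Perdrix, R. Vilmart, *A Complete Axiomatisation of the ZX-Calculus for Clifford+T Quantum
  Mechanics*, LICS 2018, arXiv:1705.11151, Appendix, Definition 3 and Lemmas 20–27 [JeandelPerdrixVilmart2018]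
  (in the journal version, LMCS 16(2):11 (2020), arXiv:1903.06035, these are Lemmas 31–38).
-/

noncomputable section

namespace Literature.Computability.QuantumComplexity

open ZXDiagram ZXClass

namespace ZXDiagram

/-- **The triangle node** `T : 1 → 1`, `⟦T⟧ = |0⟩⟨0| + |0⟩⟨1| + |1⟩⟨1|`:
`Z^{(1,2)} ⨾ (𝕀 ⊗ (X^{(1,2)} ⨾ (Z^{(1,0)}(-π/4) ⊗ Z^{(1,0)}(-π/4)))) ⨾ (X^{(1,2)} ⨾ (Z^{(1,0)}(π/4) ⊗ 𝕀)) ⨾ Z(π/4) ⨾ X(π/2)`.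
[cite: JeandelPerdrixVilmart2018, §6 (Definition of the triangle)] -/
def triangle : ZXDiagram 1 1 :=
  Z 1 2 0 ⨾ (wires 1 ⊗ (X 1 2 0 ⨾ (Z 1 0 (-1) ⊗ Z 1 0 (-1)))) ⨾ xLeafL 0 1 ⨾ Z 1 1 1 ⨾ X 1 1 2

end ZXDiagram

namespace ZXClass

/-- The triangle's class, unfolded. [cite: JeandelPerdrixVilmart2018, §6 (Definition of the triangle)] -/
theorem mk_triangle : mk triangle =
    mk (Z 1 2 0) ⨟ (mk (wires 1) ⊠ (mk (X 1 2 0) ⨟ (mk (Z 1 0 (-1)) ⊠ mk (Z 1 0 (-1))))) ⨟ mk (xLeafL 0 1) ⨟ mk (Z 1 1 1) ⨟ mk (X 1 1 2) := by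
  simp only [triangle, mk_seq, mk_par]

/-- The (BW) left-hand gadget's class, unfolded. [cite: JeandelPerdrixVilmart2018, Fig. 1 (BW)] -/
theorem mk_bwT (k : ZMod 8) : mk (bwT k) = mk (Z 1 2 0) ⨟ (mk (wires 1) ⊠ (mk (X 1 2 k) ⨟ (mk (Z 1 0 1) ⊠ mk (Z 1 0 1)))) := by
  simp only [bwT, bwLeaves, mk_seq, mk_par]

/-! ### Small tools -/

/-- A unit scalar cancels in front of `1 → 1` maps. [cite: JeandelPerdrixVilmart2018, Appendix Lemmas 5, 6] -/
theorem cancel_dumbbell_four_one_one (a : ZMod 8) {A B : ZXClass 1 1}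
    (h : mk (dumbbell 4 a) ⊠ A = mk (dumbbell 4 a) ⊠ B) : A = B := by
  have h' : mk (dumbbell 4 (-a)) ⊠ (mk (dumbbell 4 a) ⊠ A) = mk (dumbbell 4 (-a)) ⊠ (mk (dumbbell 4 a) ⊠ B) := by rw [h]
  have e : ∀ C : ZXClass 1 1, mk (dumbbell 4 (-a)) ⊠ (mk (dumbbell 4 a) ⊠ C) = mk (dumbbell 0 0) ⊠ (mk (dumbbell 0 0) ⊠ C) := by
    intro C
    rw [show mk (dumbbell 4 (-a)) ⊠ (mk (dumbbell 4 a) ⊠ C) = (mk (dumbbell 4 (-a)) ⊠ mk (dumbbell 4 a)) ⊠ C from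
        (par_assoc' _ _ _).trans (cast_id _ _ _), dumbbell_four_mul, neg_add_cancel, dumbbell_four_zero]
    exact (par_assoc _ _ _).trans (cast_id _ _ _)
  rw [e, e] at h'
  exact cancel_sqrt_two_left (cancel_sqrt_two_left h')

/-- A scalar in front of a `1 → 1 → 0` composite may be attached to either factor. [folklore] -/
theorem scalar_par_one_seq_zero (s : ZXClass 0 0) (P : ZXClass 1 1) (E : ZXClass 1 0) : (s ⊠ P) ⨟ E = s ⊠ (P ⨟ E) := by
  rw [scalar_par_seq_left, empty_par, cast_id]

/-- A scalar after a `1 → 1` map and before an effect floats out. [folklore] -/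
theorem one_seq_scalar_par_zero (P : ZXClass 1 1) (s : ZXClass 0 0) (E : ZXClass 1 0) : P ⨟ (s ⊠ E) = s ⊠ (P ⨟ E) := by
  rw [scalar_par_seq_right, empty_par, cast_id]

/-- A scalar on the gadget of a green node may be taken out. [folklore] -/
theorem Z_split_seq_par_scalar_par (s : ZXClass 0 0) (G : ZXClass 1 0) :
    mk (Z 1 2 0) ⨟ (mk (wires 1) ⊠ (s ⊠ G)) = s ⊠ (mk (Z 1 2 0) ⨟ (mk (wires 1) ⊠ G)) := by
  rw [show mk (wires 1) ⊠ (s ⊠ G) = s ⊠ (mk (wires 1) ⊠ G) from by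
      rw [show mk (wires 1) ⊠ (s ⊠ G) = (mk (wires 1) ⊠ s) ⊠ G from (par_assoc' _ _ _).trans (cast_id _ _ _),
        ← scalar_par_one_comm]; exact (par_assoc _ _ _).trans (cast_id _ _ _),
    one_two_seq_scalar_par_one]

/-- The red node with a leaf: the red phase `π` slides onto the wire.
`xLeafL π (π/4) ⨾ X(π) = xLeafL 0 (π/4)`. [cite: JeandelPerdrixVilmart2018, Fig. 1 (S1)] -/
theorem xLeafL_pi_seq_X_pi (c : ZMod 8) : mk (xLeafL 4 c) ⨟ mk (X 1 1 4) = mk (xLeafL 0 c) := by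
  simp only [xLeafL, mk_seq, mk_par]
  rw [seq_assoc, show (mk (Z 1 0 c) ⊠ mk (wires 1)) ⨟ mk (X 1 1 4) = (mk (wires 1) ⊠ mk (X 1 1 4)) ⨟ (mk (Z 1 0 c) ⊠ mk (wires 1)) from by
      rw [← par_eq_seq_right, par_eq_seq_left (mk (Z 1 0 c)) (mk (X 1 1 4)), empty_par, cast_id],
    ← seq_assoc, X_seq_par_X 1 1 1 1 le_rfl, show (4 : ZMod 8) + 4 = 0 from by decide]

/-- `X(π) ⨾ xLeafL 0 c = xLeafL π c`. [cite: JeandelPerdrixVilmart2018, Fig. 1 (S1)] -/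
theorem X_pi_seq_xLeafL (c : ZMod 8) : mk (X 1 1 4) ⨟ mk (xLeafL 0 c) = mk (xLeafL 4 c) := by
  simp only [xLeafL, mk_seq, mk_par]
  rw [← seq_assoc, X_seq_X 1 1 2 le_rfl, add_zero]

/-! ### (a) Flipping the leaves of the triangle -/

/-- **The triangle with its leaves flipped**: `db 4 2 ⊗ T = √2 ⊗ T₊` where
`T₊ = bwT 0 ⨾ xLeafL 0 (π/4) ⨾ Z(π/4) ⨾ X(π/2)` carries `+π/4` leaves on its gadget ((K) twice,
Lemma 2). [cite: JeandelPerdrixVilmart2018, Fig. 1 (K); Appendix Lemma 2] -/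
theorem triangle_flip :
    mk (dumbbell 4 2) ⊠ mk triangle = mk (dumbbell 0 0) ⊠ (mk (bwT 0) ⨟ mk (xLeafL 0 1) ⨟ mk (Z 1 1 1) ⨟ mk (X 1 1 2)) := by
  -- the gadgets as a leafy red node followed by an effect
  have hG : ∀ c : ZMod 8, mk (X 1 2 0) ⨟ (mk (Z 1 0 c) ⊠ mk (Z 1 0 c)) = mk (xLeafL 0 c) ⨟ mk (Z 1 0 c) := by
    intro c
    simp only [xLeafL, mk_seq, mk_par]
    rw [par_eq_seq_left (mk (Z 1 0 c)) (mk (Z 1 0 c)), ← seq_assoc, empty_par, cast_id]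
  -- the core: two (K) flips on the green node with its gadget
  have hcore : mk (dumbbell 4 1) ⊠ (mk (dumbbell 4 1) ⊠ (mk (Z 1 2 0) ⨟ (mk (wires 1) ⊠ (mk (X 1 2 0) ⨟ (mk (Z 1 0 (-1)) ⊠ mk (Z 1 0 (-1))))))) =
      mk (dumbbell 0 0) ⊠ (mk (dumbbell 0 0) ⊠ mk (bwT 0)) := by
    rw [hG, ← Z_split_seq_par_scalar_par, ← scalar_par_one_seq_zero, dumbbell_four_par_xLeafL_neg, zero_add (4 : ZMod 8),
      scalar_par_one_seq_zero, Z_split_seq_par_scalar_par, scalar_par_scalar_par (mk (dumbbell 4 1)) (mk (dumbbell 0 0)),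
      ← Z_split_seq_par_scalar_par, ← one_seq_scalar_par_zero, ← sqrt_two_par_X_pi_seq_Z_effect, one_seq_scalar_par_zero,
      Z_split_seq_par_scalar_par, ← seq_assoc, xLeafL_pi_seq_X_pi, ← hG, mk_bwT]
  -- attach the tail and trade `db 4 1 ⊗ db 4 1` for `db 4 2 ⊗ √2`
  apply cancel_sqrt_two_left
  rw [scalar_par_scalar_par (mk (dumbbell 0 0)) (mk (dumbbell 4 2)),
    show ∀ A : ZXClass 1 1, mk (dumbbell 4 2) ⊠ (mk (dumbbell 0 0) ⊠ A) = mk (dumbbell 4 1) ⊠ (mk (dumbbell 4 1) ⊠ A) from fun A => by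
      rw [show mk (dumbbell 4 1) ⊠ (mk (dumbbell 4 1) ⊠ A) = (mk (dumbbell 4 1) ⊠ mk (dumbbell 4 1)) ⊠ A from
          (par_assoc' _ _ _).trans (cast_id _ _ _), dumbbell_four_mul, show (1 : ZMod 8) + 1 = 2 from by decide]
      exact (par_assoc' _ _ _).trans (cast_id _ _ _),
    mk_triangle, ← scalar_par_seq_one, ← scalar_par_seq_one, ← scalar_par_seq_one, ← scalar_par_seq_one, ← scalar_par_seq_one,
    ← scalar_par_seq_one, hcore, scalar_par_seq_one, scalar_par_seq_one, scalar_par_seq_one, scalar_par_seq_one,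
    scalar_par_seq_one, scalar_par_seq_one]

/-! ### (b) `X(π)` through the flipped triangle is the right-hand side of (BW) -/

/-- `X(π) ⨾ bwT 0 = bwT π ⨾ X(π)` ((K1) on the green node, the red phase fuses into the gadget).
[cite: JeandelPerdrixVilmart2018, Fig. 1 (K1), (S1)] -/
theorem X_pi_seq_bwT_zero : mk (X 1 1 4) ⨟ mk (bwT 0) = mk (bwT 4) ⨟ mk (X 1 1 4) := by
  rw [mk_bwT, mk_bwT, ← seq_assoc, K1_red, seq_assoc, interchange, seq_id, ← seq_assoc (mk (X 1 1 4)) (mk (X 1 2 0)),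
    X_seq_X 1 1 2 le_rfl, add_zero (4 : ZMod 8), par_eq_seq_right (mk (X 1 1 4)), par_empty, seq_assoc]

/-- **`X(π) ⨾ T₊` is the right-hand side of rule (BW)** on the nose. [cite: JeandelPerdrixVilmart2018, Fig. 1 (BW), (K1)] -/
theorem X_pi_seq_trianglePlus :
    mk (X 1 1 4) ⨟ (mk (bwT 0) ⨟ mk (xLeafL 0 1) ⨟ mk (Z 1 1 1) ⨟ mk (X 1 1 2)) = mk bwRhs := by
  rw [← seq_assoc, ← seq_assoc, ← seq_assoc, X_pi_seq_bwT_zero, seq_assoc (mk (bwT 4)), X_pi_seq_xLeafL]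
  simp only [bwRhs, mk_seq]

/-! ### (c) The left-hand side of (BW) is its own transpose -/

/-- An effect on either leg of a cup. [cite: JeandelPerdrixVilmart2018, §2.2] -/
theorem cup_seq_effect_par_comm (G : ZXClass 1 0) : mk cup ⨟ (G ⊠ mk (wires 1)) = mk cup ⨟ (mk (wires 1) ⊠ G) := by
  conv_lhs => rw [← cup_swap]
  rw [seq_assoc, swap_seq_effect_par]

/-- The red `3`-legged state is symmetric in its first two legs. [cite: JeandelPerdrixVilmart2018, Fig. 1 (S1)] -/
theorem X_zero_three_seq_swap_par : mk (X 0 3 0) ⨟ (mk swap ⊠ mk (wires 1)) = mk (X 0 3 0) := by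
  rw [X_zero_three_eq_cup_xsplit_par, seq_assoc, ← seq_par_wires, X_seq_swap]

/-- **A leafy red node slides through a cup**: `η ⨾ (𝕀 ⊗ xLeafL 0 c) = η ⨾ (xLeafL 0 c ⊗ 𝕀)`.
[cite: JeandelPerdrixVilmart2018, §2.2] -/
theorem cup_seq_par_xLeafL (c : ZMod 8) : mk cup ⨟ (mk (wires 1) ⊠ mk (xLeafL 0 c)) = mk cup ⨟ (mk (xLeafL 0 c) ⊠ mk (wires 1)) := by
  simp only [xLeafL, mk_seq, mk_par]
  rw [wires_par_seq, ← seq_assoc, ← X_zero_three_eq_cup_par_xsplit, seq_par_wires, ← seq_assoc, ← X_zero_three_eq_cup_xsplit_par]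
  conv_rhs => rw [← X_zero_three_seq_swap_par, seq_assoc, ← seq_par_wires, swap_seq_effect_par]
  exact congrArg (mk (X 0 3 0) ⨟ ·) ((par_assoc (mk (wires 1)) (mk (Z 1 0 c)) (mk (wires 1))).trans (cast_id _ _ _)).symm

/-- **The leafy red node is its own transpose**: `(xLeafL k c)ᵗ = xLeafL k c`. [cite: JeandelPerdrixVilmart2018, §2.2] -/
theorem xLeafL_transpose (k c : ZMod 8) : (mk (xLeafL k c)).transpose = mk (xLeafL k c) := by
  rw [transpose_mk]
  simp only [xLeafL, ZXDiagram.transpose_seq, ZXDiagram.transpose_par, ZXDiagram.transpose_X, ZXDiagram.transpose_Z,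
    ZXDiagram.transpose_wires, mk_seq, mk_par]
  have h := Z_state_par_seq_X_merge c k
  simp only [xLeafL, mk_seq, mk_par] at h
  exact h

/-- **The green node with the (BW) gadget is its own transpose**:
`(𝕀 ⊗ ((Z^{(0,1)}(π/4))^{⊗2} ⨾ X^{(2,1)})) ⨾ Z^{(2,1)} = Z^{(1,2)} ⨾ (𝕀 ⊗ bwLeaves 0)`.
[cite: JeandelPerdrixVilmart2018, §2.2] -/
theorem par_bwLeaves_transpose_seq_merge :
    (mk (wires 1) ⊠ ((mk (Z 0 1 1) ⊠ mk (Z 0 1 1)) ⨟ mk (X 2 1 0))) ⨟ mk (Z 2 1 0) =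
      mk (Z 1 2 0) ⨟ (mk (wires 1) ⊠ (mk (X 1 2 0) ⨟ (mk (Z 1 0 1) ⊠ mk (Z 1 0 1)))) := by
  have hG : mk (X 1 2 0) ⨟ (mk (Z 1 0 1) ⊠ mk (Z 1 0 1)) = mk (xLeafL 0 1) ⨟ mk (Z 1 0 1) := by
    simp only [xLeafL, mk_seq, mk_par]
    rw [par_eq_seq_left (mk (Z 1 0 1)) (mk (Z 1 0 1)), ← seq_assoc, empty_par, cast_id]
  have hs : mk (Z 0 1 1) = mk cup ⨟ (mk (wires 1) ⊠ mk (Z 1 0 1)) := by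
    rw [← Z_zero_two, Z_seq_par_Z 0 1 1 0 le_rfl, zero_add]
  -- the right-hand side: bend the green node and slide the gadget below the merge
  rw [hG, ← par_cup_seq_merge_par, seq_assoc, show (mk (Z 2 1 0) ⊠ mk (wires 1)) ⨟ (mk (wires 1) ⊠ (mk (xLeafL 0 1) ⨟ mk (Z 1 0 1))) =
      (mk (wires 2) ⊠ (mk (xLeafL 0 1) ⨟ mk (Z 1 0 1))) ⨟ mk (Z 2 1 0) from by rw [slide, par_empty],
    ← seq_assoc, ← wires_par_wires 1 1, show (mk (wires 1) ⊠ mk (wires 1)) ⊠ (mk (xLeafL 0 1) ⨟ mk (Z 1 0 1)) =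
      mk (wires 1) ⊠ (mk (wires 1) ⊠ (mk (xLeafL 0 1) ⨟ mk (Z 1 0 1))) from (par_assoc _ _ _).trans (cast_id _ _ _),
    ← wires_par_seq, wires_par_seq 1 (mk (xLeafL 0 1)) (mk (Z 1 0 1)), ← seq_assoc (mk cup), cup_seq_par_xLeafL,
    seq_assoc (mk cup), ← par_eq_seq_left, par_eq_seq_right (mk (xLeafL 0 1)) (mk (Z 1 0 1)), par_empty,
    ← seq_assoc (mk cup), ← hs, ← Z_states_seq_X_merge]

/-- `(bwT 0)ᵗ = bwT 0`. [cite: JeandelPerdrixVilmart2018, §2.2] -/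
theorem bwT_zero_transpose : (mk (bwT 0)).transpose = mk (bwT 0) := by
  rw [transpose_mk]
  simp only [bwT, bwLeaves, ZXDiagram.transpose_seq, ZXDiagram.transpose_par, ZXDiagram.transpose_X, ZXDiagram.transpose_Z,
    ZXDiagram.transpose_wires, mk_seq, mk_par]
  exact par_bwLeaves_transpose_seq_merge

/-- **The left-hand side of (BW) is its own transpose** (a palindrome of self-transposed blocks).
[cite: JeandelPerdrixVilmart2018, Fig. 1 (BW)] -/
theorem bwLhs_transpose : (mk bwLhs).transpose = mk bwLhs := by
  rw [show mk bwLhs = mk (bwT 0) ⨟ mk (xLeafL 0 1) ⨟ mk (Z 1 1 (-2)) ⨟ mk (xLeafL 0 1) ⨟ mk (bwT 0) from by simp only [bwLhs, mk_seq],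
    transpose_seq, transpose_seq, transpose_seq, transpose_seq, bwT_zero_transpose, xLeafL_transpose, transpose_mk (Z 1 1 (-2)),
    ZXDiagram.transpose_Z]
  simp only [seq_assoc]

/-! ### (d) Appendix Lemma 21: the NOT-triangle is symmetrical -/

/-- **Appendix Lemma 21** (`not-triangle-is-symmetrical`): `X(π) ⨾ T = Tᵗ ⨾ X(π)`.
Derivation (ours, through rule (BW)): `db 4 2 ⊗ (X(π) ⨾ T) = √2 ⊗ (X(π) ⨾ T₊) = √2 ⊗ bwRhs = √2 ⊗ bwLhs`,
which is its own transpose. [cite: JeandelPerdrixVilmart2018, Appendix Lemma 21; Fig. 1 (BW)] -/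
theorem X_pi_seq_triangle : mk (X 1 1 4) ⨟ mk triangle = (mk triangle).transpose ⨟ mk (X 1 1 4) := by
  apply cancel_dumbbell_four_one_one 2
  rw [← seq_scalar_par_one, triangle_flip, seq_scalar_par_one, X_pi_seq_trianglePlus, ← scalar_par_seq_one,
    show mk (dumbbell 4 2) ⊠ (mk triangle).transpose = (mk (dumbbell 4 2) ⊠ mk triangle).transpose from by
      rw [transpose_par, transpose_mk (dumbbell 4 2), mk_transpose_dumbbell],
    triangle_flip, transpose_par, transpose_mk (dumbbell 0 0), mk_transpose_dumbbell, scalar_par_seq_one,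
    show (mk (bwT 0) ⨟ mk (xLeafL 0 1) ⨟ mk (Z 1 1 1) ⨟ mk (X 1 1 2)).transpose ⨟ mk (X 1 1 4) =
        (mk (X 1 1 4) ⨟ (mk (bwT 0) ⨟ mk (xLeafL 0 1) ⨟ mk (Z 1 1 1) ⨟ mk (X 1 1 2))).transpose from by
      rw [transpose_seq (mk (X 1 1 4)), transpose_mk (X 1 1 4), ZXDiagram.transpose_X],
    X_pi_seq_trianglePlus, ← rule_BW, bwLhs_transpose]

/-! ### Red states on the triangle (Appendix Lemmas 22–25) -/

/-- **The red `0` state absorbs green phases**: `X^{(0,1)} ⨾ Z(α) = X^{(0,1)}` ((B1), Lemma 2).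
[cite: JeandelPerdrixVilmart2018, Fig. 1 (B1); Appendix Lemma 2] -/
theorem X_state_zero_seq_Z_phase (a : ZMod 8) : mk (X 0 1 0) ⨟ mk (Z 1 1 a) = mk (X 0 1 0) := by
  apply cancel_sqrt_two_state
  rw [show mk (Z 1 1 a) = mk (Z 1 2 0) ⨟ (mk (wires 1) ⊠ mk (Z 1 0 a)) from by rw [Z_seq_par_Z 1 1 1 0 le_rfl, zero_add],
    ← seq_assoc, ← scalar_par_state_two_seq_one, rule_B1, interchange, seq_id, show mk (X 0 1 0) ⨟ mk (Z 1 0 a) = mk (dumbbell 0 a) from by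
      simp only [dumbbell, mk_seq],
    dumbbell_zero_eq, ← scalar_par_state_comm]

/-- `Z^{(0,1)} ⨾ X(α) = Z^{(0,1)}`. [cite: JeandelPerdrixVilmart2018, Fig. 1 (B1); Appendix Lemma 2] -/
theorem Z_state_zero_seq_X_phase (a : ZMod 8) : mk (Z 0 1 0) ⨟ mk (X 1 1 a) = mk (Z 0 1 0) := by
  have h := congrArg colorSwap (X_state_zero_seq_Z_phase a)
  simpa using h

/-- The closed red `π` node with two green `α` leaves: `X^{(0,2)}(π) ⨾ (Z^{(1,0)}(α))^{⊗2} = db 4 α ⊗ √2`.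
[cite: JeandelPerdrixVilmart2018, Fig. 1 (K)] -/
theorem X_pi_cup_seq_effects (a : ZMod 8) : mk (X 0 2 4) ⨟ (mk (Z 1 0 a) ⊠ mk (Z 1 0 a)) = mk (dumbbell 4 a) ⊠ mk (dumbbell 0 0) := by
  have hX : mk (X 0 2 4) = mk cup ⨟ (mk (X 1 1 4) ⊠ mk (wires 1)) := by
    have h := congrArg colorSwap (Z_seq_Z_par 0 1 1 1 le_rfl 4 0)
    simp only [colorSwap_seq, colorSwap_par, colorSwap_mk, ZXDiagram.colorSwap_Z, ZXDiagram.colorSwap_wires] at h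
    rw [add_zero] at h
    rw [← h, X_zero_two]
  apply cancel_sqrt_two_left_scalar
  rw [hX, seq_assoc, interchange, id_seq,
    show mk (dumbbell 0 0) ⊠ (mk cup ⨟ ((mk (X 1 1 4) ⨟ mk (Z 1 0 a)) ⊠ mk (Z 1 0 a))) =
        mk cup ⨟ ((mk (dumbbell 0 0) ⊠ (mk (X 1 1 4) ⨟ mk (Z 1 0 a))) ⊠ mk (Z 1 0 a)) from by
      rw [scalar_par_seq_right, empty_par, cast_id]; exact congrArg (mk cup ⨟ ·) ((par_assoc' _ _ _).trans (cast_id _ _ _)),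
    sqrt_two_par_X_pi_seq_Z_effect,
    show (mk (dumbbell 4 a) ⊠ mk (Z 1 0 (-a))) ⊠ mk (Z 1 0 a) = mk (dumbbell 4 a) ⊠ (mk (Z 1 0 (-a)) ⊠ mk (Z 1 0 a))
      from (par_assoc _ _ _).trans (cast_id _ _ _),
    state_two_seq_scalar_par_zero, par_eq_seq_left (mk (Z 1 0 (-a))) (mk (Z 1 0 a)), ← seq_assoc, cup_seq_effect_par,
    empty_par, cast_id, Z_seq_Z 0 1 0 le_rfl, neg_add_cancel, two_eq_sqrt_two_sq, scalar_par_scalar_par (mk (dumbbell 0 0)) (mk (dumbbell 4 a))]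

/-- The red `0` state through the gadget node and the leafy red node of the triangle:
`√2 ⊗ (X^{(0,1)} ⨾ Z^{(1,2)} ⨾ (𝕀 ⊗ G) ⨾ xLeafL 0 c) = (X^{(0,1)} ⨾ G) ⊗ Z^{(0,1)}(c)` for an effect `G`.
[cite: JeandelPerdrixVilmart2018, Fig. 1 (B1), (S1)] -/
theorem X_state_zero_seq_split_gadget_leaf (G : ZXClass 1 0) (c : ZMod 8) :
    mk (dumbbell 0 0) ⊠ (mk (X 0 1 0) ⨟ (mk (Z 1 2 0) ⨟ (mk (wires 1) ⊠ G)) ⨟ mk (xLeafL 0 c)) = (mk (X 0 1 0) ⨟ G) ⊠ mk (Z 0 1 c) := by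
  have hL : mk (X 0 1 0) ⨟ mk (xLeafL 0 c) = mk (Z 0 1 c) := by
    simp only [xLeafL, mk_seq, mk_par]
    rw [← seq_assoc, X_seq_X 0 1 2 le_rfl, add_zero (0 : ZMod 8), X_zero_two, cup_seq_effect_par]
  rw [← seq_assoc, ← scalar_par_state_seq, ← scalar_par_state_two_seq_one, rule_B1, interchange, seq_id,
    ← scalar_par_state_comm (mk (X 0 1 0) ⨟ G), scalar_par_state_seq, hL]

/-- **Appendix Lemma 22** (`red-state-on-triangle`): `X^{(0,1)} ⨾ T = X^{(0,1)}`.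
[cite: JeandelPerdrixVilmart2018, Appendix Lemma 22] -/
theorem X_state_zero_seq_triangle : mk (X 0 1 0) ⨟ mk triangle = mk (X 0 1 0) := by
  have hg : mk (X 0 1 0) ⨟ (mk (X 1 2 0) ⨟ (mk (Z 1 0 (-1)) ⊠ mk (Z 1 0 (-1)))) = mk (dumbbell 4 (-1)) := by
    rw [← seq_assoc, X_seq_X 0 1 2 le_rfl, add_zero (0 : ZMod 8), X_zero_two, par_eq_seq_left (mk (Z 1 0 (-1))) (mk (Z 1 0 (-1))), ← seq_assoc,
      cup_seq_effect_par, empty_par, cast_id, Z_seq_Z 0 1 0 le_rfl, show (-1 : ZMod 8) + -1 = -2 from by decide, Z_dot_neg_two_eq]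
  apply cancel_sqrt_two_state
  rw [mk_triangle, ← seq_assoc, ← seq_assoc, ← seq_assoc, ← scalar_par_state_seq, ← scalar_par_state_seq,
    X_state_zero_seq_split_gadget_leaf, hg, scalar_par_state_seq,
    scalar_par_state_seq, Z_seq_Z 0 1 1 le_rfl, show (1 : ZMod 8) + 1 = 2 from by decide, Z_state_two_eq,
    scalar_par_state_seq, scalar_par_state_seq, X_seq_X 0 1 1 le_rfl, show (-2 : ZMod 8) + 2 = 0 from by decide,
    scalar_par_scalar_par_state, scalar_par_scalar_par_state, dumbbell_four_mul, show (-1 : ZMod 8) + 1 = 0 from by decide,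
    dumbbell_four_zero, show (mk (dumbbell 0 0) ⊠ mk (dumbbell 0 0)) ⊠ mk invSqrtTwo = mk (dumbbell 0 0) ⊠ (mk (dumbbell 0 0) ⊠ mk invSqrtTwo)
      from (par_assoc _ _ _).trans (cast_id _ _ _), scalar_par_comm (mk (dumbbell 0 0)) (mk invSqrtTwo), invSqrtTwo_par_dumbbell, par_empty]

/-- The red `π` cup: `X^{(0,2)}(π) = η ⨾ (X(π) ⊗ 𝕀)`. [cite: JeandelPerdrixVilmart2018, Fig. 1 (S1)] -/
theorem X_zero_two_pi_eq : mk (X 0 2 4) = mk cup ⨟ (mk (X 1 1 4) ⊠ mk (wires 1)) := by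
  have h := congrArg colorSwap (Z_seq_Z_par 0 1 1 1 le_rfl 4 0)
  simp only [colorSwap_seq, colorSwap_par, colorSwap_mk, ZXDiagram.colorSwap_Z, ZXDiagram.colorSwap_wires] at h
  rw [add_zero] at h
  rw [← h, X_zero_two]

/-- `√2 ⊗ (X^{(0,1)}(π) ⨾ Z^{(1,2)}) = X^{(0,1)}(π) ⊗ X^{(0,1)}(π)` ((K1), (B1)). [cite: JeandelPerdrixVilmart2018, Fig. 1 (K1), (B1)] -/
theorem sqrt_two_par_X_state_pi_seq_split : mk (dumbbell 0 0) ⊠ (mk (X 0 1 4) ⨟ mk (Z 1 2 0)) = mk (X 0 1 4) ⊠ mk (X 0 1 4) := by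
  have hx : mk (X 0 1 4) = mk (X 0 1 0) ⨟ mk (X 1 1 4) := by rw [X_seq_X 0 1 1 le_rfl, zero_add]
  rw [hx, seq_assoc, K1_red, ← seq_assoc, ← scalar_par_state_two_seq_two, rule_B1, interchange]

/-- `√2 ⊗ (X^{(0,1)}(π) ⨾ xLeafL 0 c) = db 4 c ⊗ Z^{(0,1)}(-c)` ((K) on the leaf). [cite: JeandelPerdrixVilmart2018, Fig. 1 (K)] -/
theorem sqrt_two_par_X_state_pi_seq_xLeafL (c : ZMod 8) :
    mk (dumbbell 0 0) ⊠ (mk (X 0 1 4) ⨟ mk (xLeafL 0 c)) = mk (dumbbell 4 c) ⊠ mk (Z 0 1 (-c)) := by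
  simp only [xLeafL, mk_seq, mk_par]
  rw [← seq_assoc, X_seq_X 0 1 2 le_rfl, add_zero (4 : ZMod 8), X_zero_two_pi_eq, seq_assoc, ← seq_par_wires, ← state_two_seq_scalar_par_one,
    show mk (dumbbell 0 0) ⊠ ((mk (X 1 1 4) ⨟ mk (Z 1 0 c)) ⊠ mk (wires 1)) = (mk (dumbbell 0 0) ⊠ (mk (X 1 1 4) ⨟ mk (Z 1 0 c))) ⊠ mk (wires 1)
      from (par_assoc' _ _ _).trans (cast_id _ _ _), sqrt_two_par_X_pi_seq_Z_effect,
    show (mk (dumbbell 4 c) ⊠ mk (Z 1 0 (-c))) ⊠ mk (wires 1) = mk (dumbbell 4 c) ⊠ (mk (Z 1 0 (-c)) ⊠ mk (wires 1))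
      from (par_assoc _ _ _).trans (cast_id _ _ _), state_two_seq_scalar_par_one, cup_seq_effect_par]

/-- The red `π` state through the gadget node and the leafy red node:
`√2 ⊗ √2 ⊗ (X^{(0,1)}(π) ⨾ Z^{(1,2)} ⨾ (𝕀 ⊗ G) ⨾ xLeafL 0 c) = (X^{(0,1)}(π) ⨾ G) ⊗ db 4 c ⊗ Z^{(0,1)}(-c)`.
[cite: JeandelPerdrixVilmart2018, Fig. 1 (K1), (B1), (K)] -/
theorem X_state_pi_seq_split_gadget_leaf (G : ZXClass 1 0) (c : ZMod 8) :
    mk (dumbbell 0 0) ⊠ (mk (dumbbell 0 0) ⊠ (mk (X 0 1 4) ⨟ (mk (Z 1 2 0) ⨟ (mk (wires 1) ⊠ G)) ⨟ mk (xLeafL 0 c))) =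
      (mk (X 0 1 4) ⨟ G) ⊠ (mk (dumbbell 4 c) ⊠ mk (Z 0 1 (-c))) := by
  rw [← seq_assoc, ← scalar_par_state_seq, ← scalar_par_state_two_seq_one, sqrt_two_par_X_state_pi_seq_split, interchange, seq_id,
    ← scalar_par_state_comm (mk (X 0 1 4) ⨟ G), scalar_par_state_seq, scalar_par_scalar_par (mk (dumbbell 0 0)) (mk (X 0 1 4) ⨟ G),
    sqrt_two_par_X_state_pi_seq_xLeafL]

/-- **Appendix Lemma 23** (`pi-red-state-on-triangle`): `X^{(0,1)}(π) ⨾ T = √2 ⊗ Z^{(0,1)}`.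
[cite: JeandelPerdrixVilmart2018, Appendix Lemma 23] -/
theorem X_state_pi_seq_triangle : mk (X 0 1 4) ⨟ mk triangle = mk (dumbbell 0 0) ⊠ mk (Z 0 1 0) := by
  have hg : mk (X 0 1 4) ⨟ (mk (X 1 2 0) ⨟ (mk (Z 1 0 (-1)) ⊠ mk (Z 1 0 (-1)))) = mk (dumbbell 4 (-1)) ⊠ mk (dumbbell 0 0) := by
    rw [← seq_assoc, X_seq_X 0 1 2 le_rfl, add_zero (4 : ZMod 8), X_pi_cup_seq_effects]
  refine cancel_sqrt_two_state (cancel_sqrt_two_state ?_)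
  rw [mk_triangle, ← seq_assoc, ← seq_assoc, ← seq_assoc,
    ← scalar_par_state_seq, ← scalar_par_state_seq, ← scalar_par_state_seq, ← scalar_par_state_seq,
    X_state_pi_seq_split_gadget_leaf, hg, scalar_par_state_seq, scalar_par_state_seq,
    scalar_par_state_seq, scalar_par_state_seq, Z_seq_Z 0 1 1 le_rfl, neg_add_cancel, Z_state_zero_seq_X_phase,
    show (mk (dumbbell 4 (-1)) ⊠ mk (dumbbell 0 0)) ⊠ (mk (dumbbell 4 1) ⊠ mk (Z 0 1 0)) = mk (dumbbell 4 (-1)) ⊠ (mk (dumbbell 0 0) ⊠ (mk (dumbbell 4 1) ⊠ mk (Z 0 1 0)))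
      from (par_assoc _ _ _).trans (cast_id _ _ _), scalar_par_scalar_par (mk (dumbbell 0 0)) (mk (dumbbell 4 1)),
    scalar_par_scalar_par_state (mk (dumbbell 4 (-1))) (mk (dumbbell 4 1)), dumbbell_four_mul, neg_add_cancel, dumbbell_four_zero]
  exact (par_assoc _ _ _).trans (cast_id _ _ _)

/-- The transposed triangle through the red `π`: `Tᵗ = X(π) ⨾ T ⨾ X(π)`. [cite: JeandelPerdrixVilmart2018, Appendix Lemma 21] -/
theorem triangle_transpose_eq : (mk triangle).transpose = mk (X 1 1 4) ⨟ mk triangle ⨟ mk (X 1 1 4) := by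
  rw [X_pi_seq_triangle, seq_assoc, xphase_seq_xphase, show (4 : ZMod 8) + 4 = 0 from by decide, X_one_one, seq_id]

/-- **Appendix Lemma 24** (`red-state-on-upside-down-triangle`): `X^{(0,1)} ⨾ Tᵗ = √2 ⊗ Z^{(0,1)}`.
[cite: JeandelPerdrixVilmart2018, Appendix Lemma 24] -/
theorem X_state_zero_seq_triangle_transpose : mk (X 0 1 0) ⨟ (mk triangle).transpose = mk (dumbbell 0 0) ⊠ mk (Z 0 1 0) := by
  rw [triangle_transpose_eq, ← seq_assoc, ← seq_assoc, X_seq_X 0 1 1 le_rfl, zero_add, X_state_pi_seq_triangle, scalar_par_state_seq,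
    Z_state_seq_X_phase_pi]

/-- **Appendix Lemma 25** (`pi-red-state-on-upside-down-triangle`): `X^{(0,1)}(π) ⨾ Tᵗ = X^{(0,1)}(π)`.
[cite: JeandelPerdrixVilmart2018, Appendix Lemma 25] -/
theorem X_state_pi_seq_triangle_transpose : mk (X 0 1 4) ⨟ (mk triangle).transpose = mk (X 0 1 4) := by
  rw [triangle_transpose_eq, ← seq_assoc, ← seq_assoc, X_seq_X 0 1 1 le_rfl, show (4 : ZMod 8) + 4 = 0 from by decide,
    X_state_zero_seq_triangle, X_seq_X 0 1 1 le_rfl, zero_add]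

/-! ### Green `π` states on the triangles (Appendix Lemmas 26, 27) -/

/-- A green `π` slides through a leafy red node, shifting the leaf: `Z(π) ⨾ xLeafL 0 c = xLeafL 0 (c + π) ⨾ Z(π)` ((K1)).
[cite: JeandelPerdrixVilmart2018, Fig. 1 (K1)] -/
theorem Z_pi_seq_xLeafL (c : ZMod 8) : mk (Z 1 1 4) ⨟ mk (xLeafL 0 c) = mk (xLeafL 0 (c + 4)) ⨟ mk (Z 1 1 4) := by
  simp only [xLeafL, mk_seq, mk_par]
  rw [← seq_assoc, K1, seq_assoc, interchange, seq_id, Z_seq_Z 1 1 0 le_rfl, add_comm (4 : ZMod 8) c,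
    par_eq_seq_left (mk (Z 1 0 (c + 4))) (mk (Z 1 1 4)), empty_par, cast_id, seq_assoc]

/-- A cup whose second leg carries a leafy red node and an effect is the effect's state through the
leafy node: `η ⨾ (𝕀 ⊗ (xLeafL 0 c ⨾ Z^{(1,0)}(d))) = Z^{(0,1)}(d) ⨾ xLeafL 0 c`. [cite: JeandelPerdrixVilmart2018, §2.2] -/
theorem cup_seq_par_leaf_effect (c d : ZMod 8) :
    mk cup ⨟ (mk (wires 1) ⊠ (mk (xLeafL 0 c) ⨟ mk (Z 1 0 d))) = mk (Z 0 1 d) ⨟ mk (xLeafL 0 c) := by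
  have hs : mk (Z 0 1 d) = mk cup ⨟ (mk (wires 1) ⊠ mk (Z 1 0 d)) := by
    rw [← Z_zero_two, Z_seq_par_Z 0 1 1 0 le_rfl, zero_add]
  rw [wires_par_seq, ← seq_assoc, cup_seq_par_xLeafL, seq_assoc, ← par_eq_seq_left, par_eq_seq_right (mk (xLeafL 0 c)) (mk (Z 1 0 d)),
    par_empty, ← seq_assoc, ← hs]

/-- **The green `π` state on `bwT 0`**: `Z^{(0,1)}(π) ⨾ bwT 0 = Z^{(0,1)}(π/4) ⨾ xLeafL 0 (π/4) ⨾ Z(π)`.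
[cite: JeandelPerdrixVilmart2018, Fig. 1 (S1)] -/
theorem Z_state_pi_seq_bwT_zero : mk (Z 0 1 4) ⨟ mk (bwT 0) = mk (Z 0 1 1) ⨟ mk (xLeafL 0 1) ⨟ mk (Z 1 1 4) := by
  have hG : mk (X 1 2 0) ⨟ (mk (Z 1 0 1) ⊠ mk (Z 1 0 1)) = mk (xLeafL 0 1) ⨟ mk (Z 1 0 1) := by
    simp only [xLeafL, mk_seq, mk_par]
    rw [par_eq_seq_left (mk (Z 1 0 1)) (mk (Z 1 0 1)), ← seq_assoc, empty_par, cast_id]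
  rw [mk_bwT, hG, ← seq_assoc, Z_seq_Z 0 1 2 le_rfl, add_zero, ← cup_seq_phase_par, seq_assoc, interchange, seq_id, id_seq,
    par_eq_seq_right (mk (Z 1 1 4)), par_empty, ← seq_assoc, cup_seq_par_leaf_effect]

/-- **(SUP) on leaves**: `X^{(1,2)} ⨾ (Z^{(1,0)}(α) ⊗ Z^{(1,0)}(α+π)) = X^{(1,2)} ⨾ Z^{(2,0)}(2α+π)` (transpose of (SUP)).
[cite: JeandelPerdrixVilmart2018, Fig. 1 (SUP)] -/
theorem xsplit_seq_supp_effects (a : ZMod 8) :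
    mk (X 1 2 0) ⨟ (mk (Z 1 0 a) ⊠ mk (Z 1 0 (a + 4))) = mk (X 1 2 0) ⨟ mk (Z 2 0 (2 * a + 4)) := by
  have h := congrArg transpose (rule_SUP a)
  simpa using h

/-- **The Hopf law, divided**: `X^{(1,2)} ⨾ Z^{(2,1)} = 1/√2 ⊗ 1/√2 ⊗ (X^{(1,0)} ⨾ Z^{(0,1)})`. [cite: JeandelPerdrixVilmart2018, Appendix Lemma 3] -/
theorem xsplit_seq_merge_eq : mk (X 1 2 0) ⨟ mk (Z 2 1 0) = mk invSqrtTwo ⊠ (mk invSqrtTwo ⊠ (mk (X 1 0 0) ⨟ mk (Z 0 1 0))) := by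
  rw [← hopf]
  have e : ∀ A : ZXClass 1 1, mk invSqrtTwo ⊠ (mk (dumbbell 0 0) ⊠ A) = A := fun A => by
    rw [show mk invSqrtTwo ⊠ (mk (dumbbell 0 0) ⊠ A) = (mk invSqrtTwo ⊠ mk (dumbbell 0 0)) ⊠ A from (par_assoc' _ _ _).trans (cast_id _ _ _),
      invSqrtTwo_par_dumbbell, empty_par, cast_id]
  rw [e, e]

/-- **Two leafy red nodes with supplementary leaves cancel**:
`xLeafL 0 (π/4) ⨾ xLeafL 0 (5π/4) = (1/√2 ⊗ 1/√2 ⊗ db 4 (-1)) ⊗ 𝕀` ((S1), (SUP), Hopf).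
[cite: JeandelPerdrixVilmart2018, Fig. 1 (SUP); Appendix Lemma 3] -/
theorem xLeafL_one_seq_xLeafL_five :
    mk (xLeafL 0 1) ⨟ mk (xLeafL 0 5) = (mk invSqrtTwo ⊠ (mk invSqrtTwo ⊠ mk (dumbbell 4 (-1)))) ⊠ mk (wires 1) := by
  have hX13 : mk (X 1 3 0) = mk (X 1 2 0) ⨟ (mk (X 1 2 0) ⊠ mk (wires 1)) := by
    have h := congrArg colorSwap (Z_seq_Z_par 1 1 1 2 le_rfl 0 0)
    simp only [colorSwap_seq, colorSwap_par, colorSwap_mk, ZXDiagram.colorSwap_Z, ZXDiagram.colorSwap_wires] at h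
    rw [add_zero] at h
    exact h.symm
  have hX11 : mk (X 1 2 0) ⨟ (mk (X 1 0 0) ⊠ mk (wires 1)) = mk (wires 1) := by
    have h := congrArg colorSwap (Z_seq_Z_par 1 1 1 0 le_rfl 0 0)
    simp only [colorSwap_seq, colorSwap_par, colorSwap_mk, ZXDiagram.colorSwap_Z, ZXDiagram.colorSwap_wires] at h
    rw [add_zero] at h
    rw [h, X_one_one]
  simp only [xLeafL, mk_seq, mk_par]
  -- fuse the two red nodes
  rw [seq_assoc, ← seq_assoc (mk (Z 1 0 1) ⊠ mk (wires 1)) (mk (X 1 2 0)),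
    show (mk (Z 1 0 1) ⊠ mk (wires 1)) ⨟ mk (X 1 2 0) = (mk (wires 1) ⊠ mk (X 1 2 0)) ⨟ (mk (Z 1 0 1) ⊠ mk (wires 2)) from by
      rw [← par_eq_seq_right, par_eq_seq_left (mk (Z 1 0 1)) (mk (X 1 2 0)), empty_par, cast_id],
    seq_assoc, ← seq_assoc (mk (X 1 2 0)) (mk (wires 1) ⊠ mk (X 1 2 0)), X_seq_par_X 1 1 1 2 le_rfl, add_zero (0 : ZMod 8),
    show (mk (Z 1 0 1) ⊠ mk (wires 2)) ⨟ (mk (Z 1 0 5) ⊠ mk (wires 1)) = (mk (Z 1 0 1) ⊠ mk (Z 1 0 (1 + 4))) ⊠ mk (wires 1) from by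
      rw [show (1 : ZMod 8) + 4 = 5 from by decide, par_eq_seq_left (mk (Z 1 0 1)) (mk (Z 1 0 5)), seq_par_wires, empty_par, cast_id,
        ← wires_par_wires 1 1]
      exact congrArg (· ⨟ (mk (Z 1 0 5) ⊠ mk (wires 1))) ((par_assoc' (mk (Z 1 0 1)) (mk (wires 1)) (mk (wires 1))).trans (cast_id _ _ _)),
    -- (SUP) on the two leaves, then the Hopf law on the green two-legged effect
    hX13, seq_assoc, ← seq_par_wires, xsplit_seq_supp_effects, show (2 * 1 + 4 : ZMod 8) = 6 from by decide,
    show mk (Z 2 0 6) = mk (Z 2 1 0) ⨟ mk (Z 1 0 6) from by rw [Z_seq_Z 2 1 0 le_rfl, zero_add],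
    ← seq_assoc (mk (X 1 2 0)) (mk (Z 2 1 0)) (mk (Z 1 0 6)), xsplit_seq_merge_eq, scalar_par_one_seq_zero, scalar_par_one_seq_zero,
    show ∀ (s : ZXClass 0 0) (E : ZXClass 1 0), (s ⊠ E) ⊠ mk (wires 1) = s ⊠ (E ⊠ mk (wires 1)) from
      fun s E => (par_assoc _ _ _).trans (cast_id _ _ _),
    show ∀ (s : ZXClass 0 0) (E : ZXClass 1 0), (s ⊠ E) ⊠ mk (wires 1) = s ⊠ (E ⊠ mk (wires 1)) from
      fun s E => (par_assoc _ _ _).trans (cast_id _ _ _),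
    one_two_seq_scalar_par_one, one_two_seq_scalar_par_one, seq_assoc (mk (X 1 0 0)), Z_seq_Z 0 1 0 le_rfl, zero_add, seq_par_wires,
    ← seq_assoc, hX11, id_seq, show (6 : ZMod 8) = -2 from by decide, Z_dot_neg_two_eq,
    show ∀ s : ZXClass 0 0, mk invSqrtTwo ⊠ (s ⊠ mk (wires 1)) = (mk invSqrtTwo ⊠ s) ⊠ mk (wires 1) from
      fun s => (par_assoc' _ _ _).trans (cast_id _ _ _),
    show ∀ s : ZXClass 0 0, mk invSqrtTwo ⊠ (s ⊠ mk (wires 1)) = (mk invSqrtTwo ⊠ s) ⊠ mk (wires 1) from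
      fun s => (par_assoc' _ _ _).trans (cast_id _ _ _)]

/-- `√2 ⊗ 1/√2` in front of a state. [cite: JeandelPerdrixVilmart2018, Appendix Lemma 5] -/
theorem sqrt_two_par_invSqrtTwo_par (A : ZXClass 0 1) : mk (dumbbell 0 0) ⊠ (mk invSqrtTwo ⊠ A) = A := by
  rw [scalar_par_scalar_par_state, scalar_par_comm, invSqrtTwo_par_dumbbell, empty_par_state]

/-- **The green `π` state on the flipped triangle**: `Z^{(0,1)}(π) ⨾ T₊ = 1/√2 ⊗ 1/√2 ⊗ db 4 (-2) ⊗ X^{(0,1)}(π)`.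
[cite: JeandelPerdrixVilmart2018, Appendix Lemma 26 (proof)] -/
theorem Z_state_pi_seq_trianglePlus :
    mk (Z 0 1 4) ⨟ (mk (bwT 0) ⨟ mk (xLeafL 0 1) ⨟ mk (Z 1 1 1) ⨟ mk (X 1 1 2)) =
      mk invSqrtTwo ⊠ (mk invSqrtTwo ⊠ (mk (dumbbell 4 (-2)) ⊠ mk (X 0 1 4))) := by
  rw [← seq_assoc, ← seq_assoc, ← seq_assoc, Z_state_pi_seq_bwT_zero, seq_assoc (mk (Z 0 1 1) ⨟ mk (xLeafL 0 1)) (mk (Z 1 1 4)) (mk (xLeafL 0 1)),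
    Z_pi_seq_xLeafL, show (1 : ZMod 8) + 4 = 5 from by decide, ← seq_assoc (mk (Z 0 1 1) ⨟ mk (xLeafL 0 1)) (mk (xLeafL 0 5)) (mk (Z 1 1 4)),
    seq_assoc (mk (Z 0 1 1)) (mk (xLeafL 0 1)) (mk (xLeafL 0 5)), xLeafL_one_seq_xLeafL_five, state_seq_scalar_par, seq_id,
    scalar_par_state_seq, scalar_par_state_seq, scalar_par_state_seq, Z_seq_Z 0 1 1 le_rfl, Z_seq_Z 0 1 1 le_rfl,
    show (1 : ZMod 8) + 4 + 1 = -2 from by decide, Z_state_neg_two, scalar_par_state_seq, scalar_par_state_seq,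
    X_seq_X 0 1 1 le_rfl, show (2 : ZMod 8) + 2 = 4 from by decide, Z_dot_neg_two_eq,
    -- the scalars: `(1/√2 ⊗ 1/√2 ⊗ db 4 (-1)) ⊗ (1/√2 ⊗ db 4 (-1) ⊗ X) = 1/√2 ⊗ 1/√2 ⊗ db 4 (-2) ⊗ X`
    show ∀ Y : ZXClass 0 1, (mk invSqrtTwo ⊠ (mk invSqrtTwo ⊠ mk (dumbbell 4 (-1)))) ⊠ Y = mk invSqrtTwo ⊠ (mk invSqrtTwo ⊠ (mk (dumbbell 4 (-1)) ⊠ Y))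
      from fun Y => by
        rw [show (mk invSqrtTwo ⊠ (mk invSqrtTwo ⊠ mk (dumbbell 4 (-1)))) ⊠ Y = mk invSqrtTwo ⊠ ((mk invSqrtTwo ⊠ mk (dumbbell 4 (-1))) ⊠ Y)
            from (par_assoc _ _ _).trans (cast_id _ _ _)]
        exact congrArg (mk invSqrtTwo ⊠ ·) ((par_assoc _ _ _).trans (cast_id _ _ _)),
    scalar_par_scalar_par_state (mk (dumbbell 4 (-1))) (mk invSqrtTwo), scalar_par_comm (mk (dumbbell 4 (-1))) (mk invSqrtTwo),
    ← scalar_par_scalar_par_state, scalar_par_scalar_par_state (mk (dumbbell 4 (-1))) (mk (dumbbell 4 (-1))), dumbbell_four_mul,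
    show (-1 : ZMod 8) + -1 = -2 from by decide, ← scalar_par_scalar_par_state, scalar_par_scalar_par (mk (dumbbell 4 (-2))) (mk (dumbbell 0 0)),
    scalar_par_scalar_par (mk invSqrtTwo) (mk (dumbbell 0 0)), sqrt_two_par_invSqrtTwo_par]

/-- **The green `π` state on the triangle**: `√2 ⊗ √2 ⊗ (Z^{(0,1)}(π) ⨾ T) = db 4 4 ⊗ X^{(0,1)}(π)` (i.e. `-√2 |1⟩`).
[cite: JeandelPerdrixVilmart2018, Appendix Lemmas 26, 27 (proofs)] -/
theorem Z_state_pi_seq_triangle :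
    mk (dumbbell 0 0) ⊠ (mk (dumbbell 0 0) ⊠ (mk (Z 0 1 4) ⨟ mk triangle)) = mk (dumbbell 4 4) ⊠ mk (X 0 1 4) := by
  rw [scalar_par_scalar_par_state, show mk (dumbbell 0 0) ⊠ mk (dumbbell 0 0) = mk (dumbbell 4 (-2)) ⊠ mk (dumbbell 4 2) from by
      rw [← dumbbell_four_par_dumbbell_four_neg 2, scalar_par_comm], ← scalar_par_scalar_par_state, ← state_seq_scalar_par, triangle_flip,
    state_seq_scalar_par, Z_state_pi_seq_trianglePlus, sqrt_two_par_invSqrtTwo_par, scalar_par_scalar_par (mk (dumbbell 4 (-2))) (mk invSqrtTwo),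
    scalar_par_scalar_par_state (mk (dumbbell 4 (-2))) (mk (dumbbell 4 (-2))), dumbbell_four_mul, show (-2 : ZMod 8) + -2 = 4 from by decide,
    ← scalar_par_scalar_par_state, scalar_par_scalar_par (mk (dumbbell 4 4)) (mk (dumbbell 0 0)),
    scalar_par_scalar_par (mk invSqrtTwo) (mk (dumbbell 0 0)), sqrt_two_par_invSqrtTwo_par]

/-- **Appendix Lemma 26** (`pi-green-state-on-upside-down-triangle`): `Z^{(0,1)}(π) ⨾ Tᵗ = 1/√2 ⊗ X^{(0,1)}`.
[cite: JeandelPerdrixVilmart2018, Appendix Lemma 26] -/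
theorem Z_state_pi_seq_triangle_transpose : mk (Z 0 1 4) ⨟ (mk triangle).transpose = mk invSqrtTwo ⊠ mk (X 0 1 0) := by
  refine cancel_sqrt_two_state (cancel_sqrt_two_state (cancel_sqrt_two_state ?_))
  rw [triangle_transpose_eq, ← seq_assoc, ← seq_assoc, sqrt_two_par_invSqrtTwo_par,
    ← scalar_par_state_seq, ← scalar_par_state_seq, ← scalar_par_state_seq, ← scalar_par_state_seq,
    ← scalar_par_state_seq, ← scalar_par_state_seq, sqrt_two_par_Z_state_seq_X_pi, show (-4 : ZMod 8) = 4 from by decide,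
    show ∀ A : ZXClass 0 1, mk (dumbbell 0 0) ⊠ (mk (dumbbell 0 0) ⊠ (mk (dumbbell 4 4) ⊠ A)) = mk (dumbbell 4 4) ⊠ (mk (dumbbell 0 0) ⊠ (mk (dumbbell 0 0) ⊠ A))
      from fun A => by rw [scalar_par_scalar_par (mk (dumbbell 0 0)) (mk (dumbbell 4 4)), scalar_par_scalar_par (mk (dumbbell 0 0)) (mk (dumbbell 4 4))],
    scalar_par_state_seq, scalar_par_state_seq,
    scalar_par_state_seq (mk (dumbbell 0 0)) (mk (dumbbell 0 0) ⊠ mk (Z 0 1 4)) (mk triangle),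
    scalar_par_state_seq (mk (dumbbell 0 0)) (mk (Z 0 1 4)) (mk triangle), Z_state_pi_seq_triangle,
    scalar_par_state_seq, X_seq_X 0 1 1 le_rfl, show (4 : ZMod 8) + 4 = 0 from by decide, scalar_par_scalar_par_state, dumbbell_four_mul,
    show (4 : ZMod 8) + 4 = 0 from by decide, dumbbell_four_zero]
  exact (par_assoc _ _ _).trans (cast_id _ _ _)

/-- `√2 ⊗ (X^{(0,1)}(π) ⨾ Z(π)) = db 4 4 ⊗ X^{(0,1)}(π)` ((K)). [cite: JeandelPerdrixVilmart2018, Fig. 1 (K)] -/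
theorem sqrt_two_par_X_state_pi_seq_Z_pi : mk (dumbbell 0 0) ⊠ (mk (X 0 1 4) ⨟ mk (Z 1 1 4)) = mk (dumbbell 4 4) ⊠ mk (X 0 1 4) := by
  rw [show mk (X 0 1 4) = mk (X 0 1 0) ⨟ mk (X 1 1 4) from by rw [X_seq_X 0 1 1 le_rfl, zero_add], seq_assoc, ← state_seq_scalar_par,
    rule_K, state_seq_scalar_par, ← seq_assoc, X_state_seq_Z_phase_pi, X_seq_X 0 1 1 le_rfl, show (0 : ZMod 8) + -4 = 4 from by decide,
    X_seq_X 0 1 1 le_rfl, zero_add (4 : ZMod 8)]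

/-- **Appendix Lemma 27** (`pi-green-state-on-triangle`): `Z^{(0,1)}(π) ⨾ T ⨾ Z(π) = 1/√2 ⊗ X^{(0,1)}(π)`.
[cite: JeandelPerdrixVilmart2018, Appendix Lemma 27] -/
theorem Z_state_pi_seq_triangle_seq_Z_pi : mk (Z 0 1 4) ⨟ mk triangle ⨟ mk (Z 1 1 4) = mk invSqrtTwo ⊠ mk (X 0 1 4) := by
  refine cancel_sqrt_two_state (cancel_sqrt_two_state (cancel_sqrt_two_state ?_))
  rw [sqrt_two_par_invSqrtTwo_par, ← scalar_par_state_seq, ← scalar_par_state_seq, Z_state_pi_seq_triangle,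
    scalar_par_state_seq, scalar_par_scalar_par (mk (dumbbell 0 0)) (mk (dumbbell 4 4)), sqrt_two_par_X_state_pi_seq_Z_pi,
    scalar_par_scalar_par_state, dumbbell_four_mul, show (4 : ZMod 8) + 4 = 0 from by decide, dumbbell_four_zero]
  exact (par_assoc _ _ _).trans (cast_id _ _ _)

end ZXClass

end Literature.Computability.QuantumComplexity
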